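import Summits.BirchSwinnertonDyer.BirchSwinnertonDyer.Theorems.GenusKolyvaginAtTwoGenusPrimitiveSupplyAtTwoHeegnerTwinParity
import Literature.FieldTheory.FiniteFields.CubicDiscriminantRootParity
import Literature.NumberTheory.LFunctions.PrimitiveQuadraticCharacter
import Literature.NumberTheory.EllipticCurves.HeegnerHypothesisKroneckerProofs
import Literature.NumberTheory.QuadraticFields.FundamentalDiscriminant
import HarnessLib

/-!
# GK₂ route `GenusKolyvaginAtTwo`, crux `RankOneShaCellBSDTwo` (stmt-27477), LINE 41 «restriction_rigidity»:
# stub PAR `LocalTwoTorsionParity` — PROVED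

THEOREMS ONLY (no definition, no named fact, no `sorry`; standard axioms).  Nothing about BSD, the crux
`RankOneShaCellBSDTwo` or any research stub of LINE 41 is proved here; this file discharges the PRINT-grade
stub PAR (`stub_localTwoTorsionParity : LocalTwoTorsionParity`, LINE 41 v1.6+, skeleton of record
`Cruxes/MinimalTwinBSDTwo/Lines/sha_cell_restriction_rigidity_bsdidea1.lean` v1.9) OUTRIGHT:

**PAR.** For a globally minimal elliptic `W/ℚ`, an imaginary quadratic `K` with ODD discriminant `d_K`
satisfying the Heegner hypothesis for `N(W)`, the local `2`-torsion dimensions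
`i_ℓ(W) = log₂ (1 + #{x ∈ 𝔽_ℓ : 4x³ + b₂x² + 2b₄x + b₆ = 0}) = dim_{𝔽₂} W(𝔽_ℓ)[2]` at the primes `ℓ ∣ d_K`
satisfy **`Σ_{ℓ ∣ d_K} i_ℓ(W) ≡ 𝟙[Δ_W < 0] (mod 2)`** (`localTwoTorsionParity`; the statement is the line's
`LocalTwoTorsionParity` with its `localTwoTorsionDim` unfolded, and `localTwoTorsionParity_holds` carries the
line's binders verbatim, so the stub closes by name).  The `2`-torsion hypothesis of the line's text is idle.

Proof = S1 + S2 of the pen's birth skeleton `line41/bc/par_birth.lean`: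
* S1 (Stickelberger for the `2`-division cubic, tree theorem
  `WeierstrassCurve.log_two_natCard_twoTorsionPolynomial_roots_add_one_mod_two_eq_one_iff`,
  `Literature/FieldTheory/FiniteFields/CubicDiscriminantRootParity`): at an odd prime `ℓ ∤ Δ`, `i_ℓ` is odd
  iff `Δ` is a non-square mod `ℓ`;
* S2: every `ℓ ∣ d_K` is an odd prime of good reduction (`ℓ` ramified ⟹ `ℓ ∤ N` by
  `Literature.SatisfiesHeegnerHypothesis.not_dvd_discr` ⟹ `ℓ ∤ Δ_min`, tree
  `GenusKolyTwin.dvd_conductorNorm_of_dvd_minimalDiscriminantInt`), and the Jacobi symbol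
  **`(Δ_min | |d_K|) = sign Δ_min`** is ALREADY the tree theorem
  `GenusKolyTwin.jacobiSym_minimalDiscriminantInt_natAbs_discr` (gk2-p5 g2, `…HeegnerTwinParity`); since `|d_K|` is
  squarefree, `(Δ_min | |d_K|) = ∏_{ℓ ∣ d_K} (Δ_min/ℓ)` with each factor `±1`, so the number of `ℓ ∣ d_K` with `Δ_min`
  a non-residue is odd iff `Δ_min < 0` (`card_primeFactors_discr_filter_not_isSquare_mod_two`), and S1 turns this
  count into `Σ i_ℓ (mod 2)`.

Instrument record (pen bsd-idea-1 g30): `par_check.py` / `par_split_check.py`, 171/171 frames.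
[cite: Kramer1981, Prop. 3 and Thm. 1] [cite: Swan1962, Corollary 1]
-/

noncomputable section

open scoped Classical NumberField

namespace Summit.BirchSwinnertonDyer.BirchSwinnertonDyer.Theorems.GenusExact.ShaCell.LocalParity

open WeierstrassCurve NumberField Literature.NumberTheory.EllipticCurves

/-! ## §1. From the Jacobi symbol to the residue count -/

section Jacobi

open Literature.NumberTheory.LFunctions.PrimitiveQuadratic (jacobiSym_finset_prod_right)

/-- From the Jacobi symbol to the residue count: if `D` is squarefree, every prime `ℓ ∣ D` is prime to
`Δ`, and `J(Δ | D) = sign Δ`, then **the number of primes `ℓ ∣ D` at which `Δ` is a non-residue is odd iff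
`Δ < 0`** (`J(Δ | D) = ∏_{ℓ ∣ D} (Δ/ℓ)`, each factor `±1`, `= −1` iff non-residue). [folklore] -/
theorem card_filter_not_isSquare_mod_two {D : ℕ} (hD : Squarefree D) {Δ : ℤ} (hΔ : Δ ≠ 0)
    (hcop : ∀ ℓ ∈ D.primeFactors, ¬ (ℓ : ℤ) ∣ Δ) (hJ : jacobiSym Δ D = Δ.sign) :
    (D.primeFactors.filter fun ℓ => ¬ IsSquare ((Δ : ℤ) : ZMod ℓ)).card % 2 = if Δ < 0 then 1 else 0 := by
  have hprod : jacobiSym Δ D = ∏ ℓ ∈ D.primeFactors, jacobiSym Δ ℓ := by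
    conv_lhs => rw [← Nat.prod_primeFactors_of_squarefree hD]
    exact jacobiSym_finset_prod_right Δ fun ℓ hℓ => (Nat.prime_of_mem_primeFactors hℓ).ne_zero
  have hterm : ∀ ℓ ∈ D.primeFactors,
      jacobiSym Δ ℓ = if ¬ IsSquare ((Δ : ℤ) : ZMod ℓ) then -1 else 1 := by
    intro ℓ hℓ
    haveI : Fact ℓ.Prime := ⟨Nat.prime_of_mem_primeFactors hℓ⟩
    rw [← jacobiSym.legendreSym.to_jacobiSym]
    by_cases h : IsSquare ((Δ : ℤ) : ZMod ℓ)
    · rw [if_neg (not_not.mpr h)]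
      exact (legendreSym.eq_one_iff ℓ fun h0 =>
        hcop ℓ hℓ ((ZMod.intCast_zmod_eq_zero_iff_dvd Δ ℓ).mp h0)).mpr h
    · rw [if_pos h]
      exact (legendreSym.eq_neg_one_iff ℓ).mpr h
  rw [hprod, Finset.prod_congr rfl hterm, Finset.prod_ite, Finset.prod_const, Finset.prod_const_one,
    mul_one] at hJ
  by_cases hlt : Δ < 0
  · rw [Int.sign_eq_neg_one_of_neg hlt] at hJ
    rw [if_pos hlt]
    rcases Nat.even_or_odd (D.primeFactors.filter fun ℓ => ¬ IsSquare ((Δ : ℤ) : ZMod ℓ)).card with he | ho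
    · rw [he.neg_one_pow] at hJ; exact absurd hJ (by decide)
    · exact Nat.odd_iff.mp ho
  · rw [Int.sign_eq_one_of_pos (lt_of_le_of_ne (not_lt.mp hlt) hΔ.symm)] at hJ
    rw [if_neg hlt]
    rcases Nat.even_or_odd (D.primeFactors.filter fun ℓ => ¬ IsSquare ((Δ : ℤ) : ZMod ℓ)).card with he | ho
    · exact Nat.even_iff.mp he
    · rw [ho.neg_one_pow] at hJ; exact absurd hJ (by decide)

end Jacobi

/-! ## §2. Odd Heegner frames: the ramified primes are odd primes of good reduction; S1 and S2 there -/

section Frame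

variable (W : WeierstrassCurve ℚ) [W.IsElliptic] [W.IsGloballyMinimal]
variable {K : Type} [Field K] [NumberField K]

/-- On a Heegner frame (every `p ∣ N(W)` splits in the quadratic field `K`) **a prime dividing `d_K` does
not divide the minimal discriminant**: it is ramified, hence does not divide `N` (`not_dvd_discr`), hence is
of good reduction. [folklore] -/
theorem not_dvd_minimalDiscriminantInt_of_dvd_discr (hK2 : Module.finrank ℚ K = 2)
    (hH : SatisfiesHeegnerHypothesis (W.conductorNorm ℤ) K) {ℓ : ℕ} (hℓ : ℓ.Prime)
    (hℓd : (ℓ : ℤ) ∣ NumberField.discr K) : ¬ (ℓ : ℤ) ∣ minimalDiscriminantInt W := fun h =>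
  Literature.SatisfiesHeegnerHypothesis.not_dvd_discr hK2 hH hℓ
    (GenusKolyTwin.dvd_conductorNorm_of_dvd_minimalDiscriminantInt W hℓ h) hℓd

/-- **S2, counted**: on an odd Heegner frame the number of primes `ℓ ∣ d_K` at which `Δ_min(W)` is a
quadratic NON-residue is odd iff `Δ_min(W) < 0` — the tree's `GenusKolyTwin.jacobiSym_minimalDiscriminantInt_natAbs_discr`
(`(Δ_min | |d_K|) = sign Δ_min`) read prime by prime over the squarefree `|d_K|`. [cite: IrelandRosen1990, Prop. 5.2.2] -/
theorem card_primeFactors_discr_filter_not_isSquare_mod_two (hK : IsImaginaryQuadratic K)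
    (hodd : Odd (NumberField.discr K)) (hH : SatisfiesHeegnerHypothesis (W.conductorNorm ℤ) K) :
    ((NumberField.discr K).natAbs.primeFactors.filter fun ℓ =>
        ¬ IsSquare ((minimalDiscriminantInt W : ℤ) : ZMod ℓ)).card % 2 =
      if minimalDiscriminantInt W < 0 then 1 else 0 := by
  have hsf : Squarefree (NumberField.discr K).natAbs := by
    rcases Literature.NumberTheory.QuadraticFields.Quadratic.isFundamentalDiscriminant_discr (K := K) hK.1
      with ⟨-, hsq, -⟩ | ⟨h4, -, -⟩
    · exact Int.squarefree_natAbs.mpr hsq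
    · exfalso; rw [Int.odd_iff] at hodd; omega
  refine card_filter_not_isSquare_mod_two hsf (minimalDiscriminantInt_ne_zero W) (fun ℓ hℓ => ?_)
    (GenusKolyTwin.jacobiSym_minimalDiscriminantInt_natAbs_discr W hK hodd hH)
  exact not_dvd_minimalDiscriminantInt_of_dvd_discr W hK.1 hH (Nat.prime_of_mem_primeFactors hℓ)
    (Int.natCast_dvd.mpr (Nat.dvd_of_mem_primeFactors hℓ))

/-- **S1 at a ramified prime of an odd Heegner frame**: for `ℓ ∣ d_K` (odd, of good reduction) the local
`2`-torsion dimension `i_ℓ(W) = log₂ (1 + #roots of the 2-division cubic of the minimal model mod ℓ)` is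
ODD iff `Δ_min(W)` is a non-residue mod `ℓ` (Stickelberger for cubics,
`WeierstrassCurve.log_two_natCard_twoTorsionPolynomial_roots_add_one_mod_two_eq_one_iff`).
[cite: Swan1962, Corollary 1] -/
theorem localTwoTorsionDim_mod_two_eq_one_iff (hK : IsImaginaryQuadratic K)
    (hodd : Odd (NumberField.discr K)) (hH : SatisfiesHeegnerHypothesis (W.conductorNorm ℤ) K)
    {ℓ : ℕ} (hℓ : ℓ ∈ (NumberField.discr K).natAbs.primeFactors) :
    Nat.log 2 (Nat.card {x : ZMod ℓ // (WeierstrassCurve.twoTorsionPolynomial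
        ((integralModelInt W).map (Int.castRingHom (ZMod ℓ)))).toPoly.eval x = 0} + 1) % 2 = 1 ↔
      ¬ IsSquare ((minimalDiscriminantInt W : ℤ) : ZMod ℓ) := by
  have hℓp : ℓ.Prime := Nat.prime_of_mem_primeFactors hℓ
  haveI : Fact ℓ.Prime := ⟨hℓp⟩
  haveI : NeZero ℓ := ⟨hℓp.ne_zero⟩
  have hℓd : ℓ ∣ (NumberField.discr K).natAbs := Nat.dvd_of_mem_primeFactors hℓ
  -- `ℓ` is odd
  have hℓ2 : ℓ ≠ 2 := by
    rintro rfl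
    exact (Int.natAbs_even.not.mpr (Int.not_even_iff_odd.mpr hodd)) (even_iff_two_dvd.mpr hℓd)
  have h2 : (2 : ZMod ℓ) ≠ 0 := by
    intro h
    have h' : ((2 : ℕ) : ZMod ℓ) = 0 := by exact_mod_cast h
    rcases (Nat.dvd_prime Nat.prime_two).mp ((ZMod.natCast_eq_zero_iff 2 ℓ).mp h') with h1 | h1
    · exact hℓp.one_lt.ne' h1
    · exact hℓ2 h1
  -- `ℓ ∤ Δ_min`
  have hΔ : ((integralModelInt W).map (Int.castRingHom (ZMod ℓ))).Δ ≠ 0 := by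
    rw [WeierstrassCurve.map_Δ, eq_intCast]
    exact fun h0 => not_dvd_minimalDiscriminantInt_of_dvd_discr W hK.1 hH hℓp (Int.natCast_dvd.mpr hℓd)
      ((ZMod.intCast_zmod_eq_zero_iff_dvd _ ℓ).mp h0)
  rw [WeierstrassCurve.log_two_natCard_twoTorsionPolynomial_roots_add_one_mod_two_eq_one_iff _ h2 hΔ,
    WeierstrassCurve.map_Δ, eq_intCast]
  rfl

end Frame

/-! ## §3. PAR -/

/-- **PAR · LOCAL TWO-TORSION PARITY on odd Heegner frames** (LINE 41 v1.6+ `LocalTwoTorsionParity`, with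
`localTwoTorsionDim` unfolded; no `2`-torsion hypothesis needed): for `W/ℚ` globally minimal elliptic and `K`
imaginary quadratic with odd `d_K` satisfying the Heegner hypothesis for `N(W)`,
**`Σ_{ℓ ∣ d_K} i_ℓ(W) ≡ 𝟙[Δ_W < 0] (mod 2)`**, `i_ℓ(W) = log₂ (1 + #roots of 4x³ + b₂x² + 2b₄x + b₆ mod ℓ)`.
[cite: Kramer1981, Prop. 3 and Thm. 1] -/
theorem localTwoTorsionParity (W : WeierstrassCurve ℚ) [W.IsElliptic] [W.IsGloballyMinimal]
    (K : Type) [Field K] [NumberField K] (hK : IsImaginaryQuadratic K) (hodd : Odd (NumberField.discr K))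
    (hH : SatisfiesHeegnerHypothesis (W.conductorNorm ℤ) K) :
    (Finset.sum (NumberField.discr K).natAbs.primeFactors (fun ℓ =>
        Nat.log 2 (Nat.card {x : ZMod ℓ // (WeierstrassCurve.twoTorsionPolynomial
          ((WeierstrassCurve.integralModelInt W).map (Int.castRingHom (ZMod ℓ)))).toPoly.eval x = 0} + 1)))
        % 2 = if W.Δ < 0 then 1 else 0 := by
  have hsign : (W.Δ < 0) ↔ minimalDiscriminantInt W < 0 := by
    rw [← cast_minimalDiscriminantInt W]; exact Int.cast_lt_zero
  have hcount := card_primeFactors_discr_filter_not_isSquare_mod_two W hK hodd hH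
  simp only [← hsign] at hcount
  rw [← hcount, Finset.sum_nat_mod, Finset.card_eq_sum_ones, Finset.sum_filter]
  congr 1
  refine Finset.sum_congr rfl fun ℓ hℓ => ?_
  have key := localTwoTorsionDim_mod_two_eq_one_iff W hK hodd hH hℓ
  by_cases hsq : IsSquare ((minimalDiscriminantInt W : ℤ) : ZMod ℓ)
  · rw [if_neg (not_not.mpr hsq)]
    have : ¬ (_ % 2 = 1) := fun h => (key.mp h) hsq
    omega
  · rw [if_pos hsq]
    exact key.mpr hsq

/-- **PAR with the line's binders VERBATIM** (LINE 41 v1.9 `LocalTwoTorsionParity`, incl. the idle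
`[NeZero N]` and `W(ℚ)[2] = 0` binders), so that `stub_localTwoTorsionParity` closes BY NAME after unfolding
`localTwoTorsionDim`. [cite: Kramer1981, Prop. 3 and Thm. 1] -/
theorem localTwoTorsionParity_holds :
    ∀ (W : WeierstrassCurve ℚ) [W.IsElliptic] [W.IsGloballyMinimal] [NeZero (W.conductorNorm ℤ)],
      (∀ P : W.toAffine.Point, 2 • P = 0 → P = 0) →
      ∀ (K : Type) [Field K] [NumberField K], IsImaginaryQuadratic K → Odd (NumberField.discr K) →
        SatisfiesHeegnerHypothesis (W.conductorNorm ℤ) K →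
          (Finset.sum (NumberField.discr K).natAbs.primeFactors (fun ℓ =>
            Nat.log 2 (Nat.card {x : ZMod ℓ // (WeierstrassCurve.twoTorsionPolynomial
              ((WeierstrassCurve.integralModelInt W).map (Int.castRingHom (ZMod ℓ)))).toPoly.eval x = 0}
                + 1))) % 2 = if W.Δ < 0 then 1 else 0 :=
  fun W _ _ _ _ K _ _ hK hodd hH => localTwoTorsionParity W K hK hodd hH

end Summit.BirchSwinnertonDyer.BirchSwinnertonDyer.Theorems.GenusExact.ShaCell.LocalParity

end
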